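import Literature.Analysis.FluidPDE.SobolevWholeSpace
import HarnessLib

/-!
# The local Sobolev inequality `‖f‖_{L⁶(B_r)} ≲ ‖Df‖_{L²(B_{2r})} + r⁻¹‖f‖_{L²(B_{2r})}` on balls

Analysis/FluidPDE support file (serves the discharge of the nonlinear estimate `Y₆` in Tao 2011,
§10, arXiv:1108.1165 p. 32: "from the Sobolev inequality one has
`‖ω‖_{L⁶(Bᵢ)} ≲ ‖ωψᵢ‖_{L⁶(ℝ³)} ≲ ‖∇(ωψᵢ)‖_{L²(ℝ³)} ≲ ‖∇ω‖_{L²(3Bᵢ)} + rᵢ⁻¹‖ω‖_{L²(3Bᵢ)}`").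

On a `3`-dimensional real inner product space `E` (Lebesgue measure) and for `C¹` maps into a
finite-dimensional real normed space `F`: there is an absolute constant `C ≥ 0` (the gradient
bound of the tree's cut-off `Fluid.cutoff`, `WholeSpaceIBP`) such that for every ball
`B(x₀, r)`, `r > 0`,

  `‖f‖_{L⁶(B(x₀,r))} ≤ K (‖Df‖_{L²(B̄(x₀,2r))} + (C/r) ‖f‖_{L²(B̄(x₀,2r))})`,

`K = SNormLESNormFDerivOfEqConst F (volume : Measure E) 2` Mathlib's Gagliardo–Nirenberg–Sobolev constant
(`eLpNorm_six_ball_le`). Proof exactly as printed: truncate with the translated cut-off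
`χ_r(· − x₀)` (`= 1` on `B(x₀, r)`, supported in `B̄(x₀, 2r)`, `‖Dχ_r‖ ≤ C/r`), apply Mathlib's
`MeasureTheory.eLpNorm_le_eLpNorm_fderiv_of_eq` to `χ_r(· − x₀) f ∈ C¹_c`, and use the Leibniz
bound `‖D(χf)‖ ≤ ‖Df‖ + (C/r)‖f‖` on the support.

## Mathlib / tree search

Mathlib: `eLpNorm_le_eLpNorm_fderiv_of_eq` (GNS for `C¹_c`), `eLpNorm_indicator_eq_eLpNorm_restrict`,
`eLpNorm_restrict_eq_of_support_subset`, `support_fderiv_subset`; no local (ball) form of the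
Sobolev inequality (`lean search 'eLpNorm.*ball|Sobolev.*ball'`). Tree: `Fluid.cutoff`,
`exists_norm_fderiv_cutoff_le` (`WholeSpaceIBP`), the whole-space form without compact support
`eLpNorm_six_le_eLpNorm_fderiv_two` (`SobolevWholeSpace`, not usable locally).

## References

* L. C. Evans, *Partial Differential Equations*, 2nd ed. (2010), §5.6.1 Thm. 1 (GNS) and the
  localisation by cut-off in the proof of §5.6.1 Thm. 2.
* T. Tao, *Localisation and compactness properties of the Navier–Stokes global regularity
  problem*, Anal. PDE 6 (2013) = arXiv:1108.1165, §10, p. 32.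
-/

noncomputable section

open MeasureTheory Set Filter Metric Function Module
open scoped ENNReal NNReal Topology

namespace Literature.Analysis.FluidPDE

namespace LocalSobolevBall

variable {E : Type*} [NormedAddCommGroup E] [InnerProductSpace ℝ E] [FiniteDimensional ℝ E]
  [MeasurableSpace E] [BorelSpace E]
variable {F : Type*} [NormedAddCommGroup F] [NormedSpace ℝ F]

omit [FiniteDimensional ℝ E] [MeasurableSpace E] [BorelSpace E] in
/-- Leibniz bound for the translated truncation: `‖D(χ_r(· − x₀) f)(y)‖ ≤ ‖Df(y)‖ + (C/r)‖f(y)‖`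
when `‖Dχ_r‖ ≤ C/r` (`|χ_r| ≤ 1`). [folklore] -/
theorem norm_fderiv_cutoff_sub_smul_le {f : E → F} (hf : ContDiff ℝ 1 f) {C r : ℝ}
    (hC : ∀ x : E, ‖fderiv ℝ (cutoff r) x‖ ≤ C / r) (x₀ y : E) :
    ‖fderiv ℝ (fun z => cutoff r (z - x₀) • f z) y‖ ≤ ‖fderiv ℝ f y‖ + C / r * ‖f y‖ := by
  have hχd : Differentiable ℝ (cutoff (E := E) r) :=
    (contDiff_cutoff (n := 1) r).differentiable one_ne_zero
  have hχ : DifferentiableAt ℝ (fun z : E => cutoff r (z - x₀)) y :=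
    DifferentiableAt.comp (g := cutoff r) y (hχd (y - x₀)) (differentiableAt_id.sub_const x₀)
  have hfy : DifferentiableAt ℝ f y := (hf.differentiable one_ne_zero) y
  have hDχ : fderiv ℝ (fun z : E => cutoff r (z - x₀)) y = fderiv ℝ (cutoff r) (y - x₀) :=
    fderiv_comp_sub x₀
  rw [fderiv_fun_smul hχ hfy, hDχ]
  calc ‖cutoff r (y - x₀) • fderiv ℝ f y + (fderiv ℝ (cutoff r) (y - x₀)).smulRight (f y)‖
      ≤ ‖cutoff r (y - x₀) • fderiv ℝ f y‖ + ‖(fderiv ℝ (cutoff r) (y - x₀)).smulRight (f y)‖ :=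
        norm_add_le _ _
    _ ≤ ‖fderiv ℝ f y‖ + C / r * ‖f y‖ := by
        gcongr
        · rw [norm_smul, Real.norm_eq_abs]
          exact mul_le_of_le_one_left (norm_nonneg _) (abs_cutoff_le_one r _)
        · rw [ContinuousLinearMap.norm_smulRight_apply]
          exact mul_le_mul_of_nonneg_right (hC _) (norm_nonneg _)

omit [FiniteDimensional ℝ E] in
/-- `L²` form of the Leibniz bound on any measure:
`‖D(χ_r(· − x₀) f)‖_{L²(μ)} ≤ ‖Df‖_{L²(μ)} + (C/r)‖f‖_{L²(μ)}`. [folklore] -/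
theorem eLpNorm_fderiv_cutoff_sub_smul_le (μ : Measure E) {f : E → F} (hf : ContDiff ℝ 1 f)
    {C r : ℝ} (hC0 : 0 ≤ C) (hr : 0 < r) (hC : ∀ x : E, ‖fderiv ℝ (cutoff r) x‖ ≤ C / r)
    (x₀ : E) :
    eLpNorm (fderiv ℝ fun z => cutoff r (z - x₀) • f z) 2 μ ≤
      eLpNorm (fderiv ℝ f) 2 μ + ENNReal.ofReal (C / r) * eLpNorm f 2 μ := by
  have hmeas₁ : AEStronglyMeasurable (fun x => ‖fderiv ℝ f x‖) μ :=
    (hf.continuous_fderiv one_ne_zero).norm.aestronglyMeasurable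
  have hmeas₂ : AEStronglyMeasurable (fun x => C / r * ‖f x‖) μ :=
    (continuous_const.mul hf.continuous.norm).aestronglyMeasurable
  calc eLpNorm (fderiv ℝ fun z => cutoff r (z - x₀) • f z) 2 μ
      ≤ eLpNorm (fun x => ‖fderiv ℝ f x‖ + C / r * ‖f x‖) 2 μ :=
        eLpNorm_mono_real (norm_fderiv_cutoff_sub_smul_le hf hC x₀)
    _ ≤ eLpNorm (fun x => ‖fderiv ℝ f x‖) 2 μ + eLpNorm (fun x => C / r * ‖f x‖) 2 μ :=
        eLpNorm_add_le hmeas₁ hmeas₂ one_le_two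
    _ = eLpNorm (fderiv ℝ f) 2 μ + ENNReal.ofReal (C / r) * eLpNorm f 2 μ := by
        rw [eLpNorm_norm]
        congr 1
        have : (fun x => C / r * ‖f x‖) = (C / r) • fun x => ‖f x‖ := rfl
        rw [this, eLpNorm_const_smul, eLpNorm_norm, Real.enorm_eq_ofReal (by positivity)]

variable [FiniteDimensional ℝ F]

/-- **Local Sobolev inequality on balls (dimension `3`).** There is an absolute constant `C ≥ 0`
such that for every `C¹` map `f : E → F` (`dim E = 3`), every `x₀` and every `r > 0`,
`‖f‖_{L⁶(B(x₀,r))} ≤ K (‖Df‖_{L²(B̄(x₀,2r))} + (C/r)‖f‖_{L²(B̄(x₀,2r))})` with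
`K = SNormLESNormFDerivOfEqConst F (volume : Measure E) 2` (GNS applied to the truncation `χ_r(· − x₀)f`; Evans,
*PDE*, §5.6.1; the form used on Whitney balls in Tao 2011, §10). [cite: Evans2010, §5.6.1 Thm. 1] -/
theorem eLpNorm_six_ball_le (hE : finrank ℝ E = 3) :
    ∃ C : ℝ, 0 ≤ C ∧ ∀ {f : E → F} (_ : ContDiff ℝ 1 f) (x₀ : E) {r : ℝ} (_ : 0 < r),
      eLpNorm f 6 (volume.restrict (ball x₀ r)) ≤
        SNormLESNormFDerivOfEqConst F (volume : Measure E) 2 *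
          (eLpNorm (fderiv ℝ f) 2 (volume.restrict (closedBall x₀ (2 * r))) +
            ENNReal.ofReal (C / r) * eLpNorm f 2 (volume.restrict (closedBall x₀ (2 * r)))) := by
  obtain ⟨C, hC0, hC⟩ := exists_norm_fderiv_cutoff_le (E := E)
  refine ⟨C, hC0, fun {f} hf x₀ {r} hr => ?_⟩
  set g : E → F := fun z => cutoff r (z - x₀) • f z with hg
  have hg1 : ContDiff ℝ 1 g := ((contDiff_cutoff r).comp (contDiff_id.sub contDiff_const)).smul hf
  -- support of `g` and of `Dg`
  have hsupp : support g ⊆ closedBall x₀ (2 * r) := by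
    intro z hz
    rw [mem_closedBall, dist_eq_norm]
    by_contra h
    exact hz (by simp only [hg, cutoff_eq_zero hr (not_le.1 h).le, zero_smul])
  have htsupp : tsupport g ⊆ closedBall x₀ (2 * r) := closure_minimal hsupp isClosed_closedBall
  have hgc : HasCompactSupport g :=
    IsCompact.of_isClosed_subset (isCompact_closedBall _ _) (isClosed_tsupport _) htsupp
  have hDsupp : support (fderiv ℝ g) ⊆ closedBall x₀ (2 * r) :=
    (support_fderiv_subset ℝ).trans htsupp
  -- GNS for the truncation
  have hGNS : eLpNorm g 6 volume ≤
      SNormLESNormFDerivOfEqConst F (volume : Measure E) 2 * eLpNorm (fderiv ℝ g) 2 volume := by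
    have h := eLpNorm_le_eLpNorm_fderiv_of_eq volume hg1 hgc (p := 2) (p' := 6) one_le_two
      (by rw [hE]; norm_num) (by rw [hE]; norm_num)
    exact_mod_cast h
  -- the left-hand side: `f = g` on the small ball
  have hB : MeasurableSet (ball x₀ r) := measurableSet_ball
  have hind : (ball x₀ r).indicator f = (ball x₀ r).indicator g := by
    funext z
    by_cases hz : z ∈ ball x₀ r
    · rw [indicator_of_mem hz, indicator_of_mem hz, hg]
      simp only
      rw [cutoff_eq_one hr (by rw [← dist_eq_norm]; exact (mem_ball.1 hz).le), one_smul]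
    · rw [indicator_of_notMem hz, indicator_of_notMem hz]
  have hL : eLpNorm f 6 (volume.restrict (ball x₀ r)) ≤ eLpNorm g 6 volume := by
    rw [← eLpNorm_indicator_eq_eLpNorm_restrict hB, hind]
    exact eLpNorm_indicator_le _
  -- the right-hand side
  have hR : eLpNorm (fderiv ℝ g) 2 volume ≤
      eLpNorm (fderiv ℝ f) 2 (volume.restrict (closedBall x₀ (2 * r))) +
        ENNReal.ofReal (C / r) * eLpNorm f 2 (volume.restrict (closedBall x₀ (2 * r))) := by
    have h2 := eLpNorm_fderiv_cutoff_sub_smul_le (volume.restrict (closedBall x₀ (2 * r)))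
      hf hC0 hr (hC r hr) x₀
    rw [← hg] at h2
    -- pass through the real-valued `‖Dg‖` to localise (its support lies in the closed ball)
    have hsuppn : support (fun z => ‖fderiv ℝ g z‖) ⊆ closedBall x₀ (2 * r) := by
      intro z hz
      by_contra hzS
      refine hz ?_
      show ‖fderiv ℝ g z‖ = 0
      rw [norm_eq_zero]
      exact notMem_support.1 fun h => hzS (hDsupp h)
    calc eLpNorm (fderiv ℝ g) 2 volume = eLpNorm (fun z => ‖fderiv ℝ g z‖) 2 volume :=
          (eLpNorm_norm _).symm
      _ = eLpNorm (fun z => ‖fderiv ℝ g z‖) 2 (volume.restrict (closedBall x₀ (2 * r))) :=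
          (eLpNorm_restrict_eq_of_support_subset hsuppn).symm
      _ = eLpNorm (fderiv ℝ g) 2 (volume.restrict (closedBall x₀ (2 * r))) := eLpNorm_norm _
      _ ≤ _ := h2
  calc eLpNorm f 6 (volume.restrict (ball x₀ r)) ≤ eLpNorm g 6 volume := hL
    _ ≤ SNormLESNormFDerivOfEqConst F (volume : Measure E) 2 * eLpNorm (fderiv ℝ g) 2 volume := hGNS
    _ ≤ _ := by gcongr

end LocalSobolevBall

end Literature.Analysis.FluidPDE

end
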